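import Mathlib
import HarnessLib
import Summits.QuantumFields.YangMills.Theorems.ParabolicTrajectoryContinuumLimitOnTrajectoryDefsC

/-!
# Alternating curvature arrays — definitions (crux `ContinuumLegGivenGap`, stmt-QuantumFields-15828, line `alternating-curvature-arrays`)

Route-posited objects of the line `alternating-curvature-arrays` (crux workfile
`Cruxes/ContinuumLegGivenGap/Lines/alternating_curvature_arrays.lean`, planner
`planner-cruxplan-stmt-QuantumFields-15828-alternating-curvatur-0`, lead c14), landed as a reviewed Defs file so that the
registered stubs of the line (`stub_arrayFunctional`, `stub_arrayExponent`, `stub_productToUniform`, and the derived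
`stub_chessboard`) can be stated and proved under `Theorems/`.  VERBATIM §1–§2 of the skeleton:

* §1 geometry of the ALTERNATING site/link-wall grid on the odd torus `2L+1 = 3^M`: cells of half-odd side `3^m/2` in
  lattice units (`cellSide`), admissible levels `3^(m+1) ∣ 2L+1` (`LevelAdmissible`, `numCells = 2 × odd` cells per axis —
  the even count a chessboard estimate needs, on an ODD torus), triadic half-sides (`IsTriadic`), the physical cell / its
  core (two lattice units inside every wall) at spacing `a` (`physCell`, `physCore`), the central half-box condition
  (`CellInHalfBox`) and the scale-invariant `C^s` cell norm (`cellNorm`);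
* §2 the mirror array of one smeared plaquette field: the dihedral transport `cellMap` / `siteMap` / `cornerMap` (translation
  by an even number of half-cells, or reflection in a wall + translation, with the base-corner shift `-e_μ` of a plaquette
  whose in-plane axis `μ` is reflected), the cell index set `cellIndices`, the mirror copy `arrayObs`, the array expectation
  `arrayMean`, its `numCells^4`-th root `arrayRoot`, and the product-bound interface `ProductBound` ((PB): one constant,
  one exponent, one flatness order, one threshold).

Sources: Fröhlich–Israel–Lieb–Simon, Comm. Math. Phys. 62 (1978) 1–34, §2 and Thm 2.2 (chessboard estimates with
reflections in lattice hyperplanes); the odd-torus mixed reflection of the tree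
(`Literature.MathematicalPhysics.QuantumFieldTheory.ConstructiveQFTWave0OddRPProofs`).  Design: cells are indexed in
LATTICE units (walls are lattice hyperplanes for every spacing `a`; triage S3), every statement quantifies over the grid
offset `v ∈ ℤ⁴` (triage S2), and the cell count is even on the odd torus by the half-odd mesh (triage S1).  Sanity checks
of the transport bookkeeping (images, periodicity mod `2L+1`, group law on samples): crux workfile
`Cruxes/ContinuumLegGivenGap/AlternatingArraysGridCheck.lean`.  NOT here: any claim about these objects (the stubs), the
abstract assignment chessboard (Literature), the composition (crux workfile §3b–§4); the one lemma here (§3,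
`numCells_eq_two_mul`: an admissible level has an even positive cell count) is the registered anchor of this file.
-/

set_option autoImplicit false

noncomputable section

namespace Summit.QuantumFields.YangMills.Theorems.ContinuumLegGivenGap.AlternatingArrays

open scoped SchwartzMap
open MeasureTheory
open Literature.MathematicalPhysics.QuantumFieldTheory Literature.MathematicalPhysics.QuantumLattice
  Literature.MathematicalPhysics.AQFT Literature.Probability.LatticeModels
open Summit.QuantumFields.YangMills.Cruxes.ContinuumLimitOnTrajectory.TwoOrbitSynchronisation (PlaqIdx plaq canonDistribution)

local notation "𝔼" => EuclideanSpace ℝ (Fin 4)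

/-! ## §1 Geometry of the alternating grid -/

/-- Side of a level-`m` cell in LATTICE units: the half-odd number `3^m / 2` (so consecutive walls of one axis
alternate between site hyperplanes and link hyperplanes — S1/S3). [folklore] -/
def cellSide (m : ℕ) : ℝ := (3 : ℝ) ^ m / 2

/-- Level `m` is admissible on the torus of side `2L+1` iff `3^(m+1) ∣ 2L+1`: then the axis carries
`numCells L m = 2(2L+1)/3^m = 2 × odd` congruent cells, an EVEN number (FILS needs it), on an ODD torus. [folklore] -/
def LevelAdmissible (L m : ℕ) : Prop := 3 ^ (m + 1) ∣ 2 * L + 1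

/-- Number of level-`m` cells per axis on the torus of side `2L+1`. [folklore] -/
def numCells (L m : ℕ) : ℕ := 2 * (2 * L + 1) / 3 ^ m

/-- The torus half-side `L` is triadic: `2L+1 = 3^M` (every level `m < M` is then admissible at once — the multiscale
ladder of ratio 3 used by the Whitney step). [folklore] -/
def IsTriadic (L : ℕ) : Prop := ∃ M : ℕ, 2 * L + 1 = 3 ^ M

/-- The closed physical cell of level `m`, grid offset `v ∈ ℤ⁴` (lattice translate of the grid, S2), index `z ∈ ℤ⁴`,
at lattice spacing `a`: `∏_μ [a(v_μ + (3^m/2) z_μ), a(v_μ + (3^m/2)(z_μ+1))]`. [folklore] -/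
def physCell (a : ℝ) (m : ℕ) (v z : Fin 4 → ℤ) : Set 𝔼 :=
  {y | ∀ μ, a * ((v μ : ℝ) + cellSide m * (z μ : ℝ)) ≤ y μ ∧ y μ ≤ a * ((v μ : ℝ) + cellSide m * ((z μ : ℝ) + 1))}

/-- The CORE of that cell: the cell shrunk by two lattice units on every side (test functions supported here smear
plaquettes that neither touch nor cross any wall of the cell, whatever the wall type). [folklore] -/
def physCore (a : ℝ) (m : ℕ) (v z : Fin 4 → ℤ) : Set 𝔼 :=
  {y | ∀ μ, a * ((v μ : ℝ) + cellSide m * (z μ : ℝ) + 2) ≤ y μ ∧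
    y μ ≤ a * ((v μ : ℝ) + cellSide m * ((z μ : ℝ) + 1) - 2)}

/-- The cell lies in the central half `[-L/2, L/2]^4` of the box of representatives `{-L,…,L}^4` (no torus seam is met
by the home cell; transported observables live on the torus and may wrap). [folklore] -/
def CellInHalfBox (L m : ℕ) (v z : Fin 4 → ℤ) : Prop :=
  ∀ μ, -((L : ℝ) / 2) ≤ (v μ : ℝ) + cellSide m * (z μ : ℝ) ∧ (v μ : ℝ) + cellSide m * ((z μ : ℝ) + 1) ≤ (L : ℝ) / 2

/-- Scale-invariant `C^s` norm of a real one-point test function at scale `ℓ`: `∑_{j ≤ s} ℓ^j · sup ‖D^j f‖`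
(for `f` supported in a cell of side `ℓ` and vanishing near its walls it dominates `(dist to wall / ℓ)^{-s} |f|`,
the wall-flatness the two-cell integral `∫∫ sᴺtᴺ(s+t)⁻⁵` needs, `2N > 3`). [folklore] -/
def cellNorm (s : ℕ) (ℓ : ℝ) (f : 𝓢(𝔼, ℝ)) : ℝ :=
  ∑ j ∈ Finset.range (s + 1), ℓ ^ j * SchwartzMap.seminorm ℝ 0 j f

/-! ## §2 The mirror array of one smeared plaquette field -/

/-- Transport of ONE lattice coordinate from the 1-d cell `z₀` to the 1-d cell `z` of the level-`m` grid with offset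
`v`: translation by `3^m (z - z₀)/2` when `z ≡ z₀ (mod 2)`, else the reflection `t ↦ 2v + 3^m (z + z₀ + 1)/2 - t` in
the wall half-way (both divisions are exact in their case).  `z ↦` this map enumerates the dihedral group generated by
the wall reflections, and it carries cell `z₀` onto cell `z`. [folklore] -/
def cellMap (m : ℕ) (v z₀ z t : ℤ) : ℤ :=
  if Even (z - z₀) then t + 3 ^ m * (z - z₀) / 2 else 2 * v + 3 ^ m * (z + z₀ + 1) / 2 - t

/-- Transport of a lattice site, coordinatewise. [folklore] -/
def siteMap (m : ℕ) (v z₀ z x : Fin 4 → ℤ) : Fin 4 → ℤ :=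
  fun μ => cellMap m (v μ) (z₀ μ) (z μ) (x μ)

/-- Base corner of the transported plaquette of orientation `q = (μ₁ < μ₂)` whose home base corner is `x`: in an axis
of the plaquette plane that is REFLECTED by the transport the corner set `{x_μ, x_μ+1}` maps to `{x'_μ - 1, x'_μ}`, so
the base corner is `siteMap x - e_μ` there (the reversed orientation does not change `Re tr`, `r` unitary). [folklore] -/
def cornerMap (m : ℕ) (v z₀ z : Fin 4 → ℤ) (q : PlaqIdx) (x : Fin 4 → ℤ) : Fin 4 → ℤ :=
  fun μ => siteMap m v z₀ z x μ - (if (μ = q.1.1 ∨ μ = q.1.2) ∧ ¬ Even (z μ - z₀ μ) then 1 else 0)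

/-- All level-`m` cells of the torus of side `2L+1`, as indices `{0, …, numCells - 1}^4` (one representative per torus
cell; indices differing by `numCells` in a coordinate give the same transported observable by periodicity). [folklore] -/
def cellIndices (L m : ℕ) : Finset (Fin 4 → ℤ) :=
  Fintype.piFinset fun _ => (Finset.range (numCells L m)).image fun n : ℕ => (n : ℤ)

section Array

variable {G : Type} [Group G] [TopologicalSpace G] [IsTopologicalGroup G] [CompactSpace G]
  [MeasurableSpace G] [BorelSpace G]

/-- **Mirror copy in cell `z`** of the canonically normalised (`c a⁴ = 1`), exactly centred, smeared plaquette field of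
orientation `q` and REAL test function `f` whose home cell is `z₀`: the test function stays at home (sites `x` of the box
of representatives), the plaquette is transported to `cornerMap … z q x` (torus-periodic observable, convention
`O at y = O ∘ configShift (-y)` of `canonDistribution`).  For `z = z₀` it is the field itself. [folklore] -/
def arrayObs (r : LatticeRep G) (βv a : ℝ) (L m : ℕ) (v z₀ z : Fin 4 → ℤ) (q : PlaqIdx) (f : 𝓢(𝔼, ℝ))
    (U : GaugeConfig 4 (2 * L + 1) G) : ℝ :=
  ∑ x ∈ box 4 L, f (a • siteToE x) *
    (plaquetteObs r.ρ 0 q.1.1 q.1.2 (configShift (-(cornerMap m v z₀ z q x)) (torusLift (2 * L + 1) U)) -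
      wilsonTorusMean r.ρ βv L (plaquetteObs r.ρ 0 q.1.1 q.1.2))

/-- **The alternating-array expectation**: Wilson expectation on the torus of side `2L+1` at inverse coupling `βv` of
the product over ALL `numCells^4` cells of the mirror copies of one smeared plaquette field (by the chessboard
estimate it is `≥ 0`; its `numCells^4`-th root is the one-body "free energy per cell" of the card). [folklore] -/
def arrayMean (r : LatticeRep G) (βv a : ℝ) (L m : ℕ) (v z₀ : Fin 4 → ℤ) (q : PlaqIdx) (f : 𝓢(𝔼, ℝ)) : ℝ :=
  ∫ U, ∏ z ∈ cellIndices L m, arrayObs r βv a L m v z₀ z q f U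
    ∂(wilsonMeasure (d := 4) (L := 2 * L + 1) r.ρ βv)

/-- **The array exponent** `γ = arrayMean ^ (1 / numCells^4)`. [folklore] -/
def arrayRoot (r : LatticeRep G) (βv a : ℝ) (L m : ℕ) (v z₀ : Fin 4 → ℤ) (q : PlaqIdx) (f : 𝓢(𝔼, ℝ)) : ℝ :=
  arrayMean r βv a L m v z₀ q f ^ ((1 : ℝ) / (numCells L m : ℝ) ^ 4)

/-- **(PB) the product bound** — interface between the chessboard side and the Whitney step: one constant `C`, one
exponent `p`, one flatness order `s`, one threshold `k₀`; beyond it the scheme's tori are triadic and, for every arity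
`n`, admissible level `m`, lattice offset `v`, plaquette orientations `q`, DISTINCT home cells `z i` in the central
half-box and real `fᵢ` supported in their cores, the canonical distribution of the tensor `⊗ᵢ fᵢ` is at most
`∏ᵢ C · max(ℓ, ℓ⁻¹)^p · cellNorm s ℓ fᵢ`, `ℓ = a_k 3^m/2` the physical cell side. [folklore] -/
def ProductBound (r : LatticeRep G) (sch : SpeciesScheme (YMSpecies G)) : Prop :=
  ∃ (C : ℝ) (p s k₀ : ℕ), 0 ≤ C ∧ ∀ k : ℕ, k₀ ≤ k → IsTriadic (sch.L k) ∧
    ∀ (n m : ℕ) (v : Fin 4 → ℤ) (q : Fin n → PlaqIdx) (z : Fin n → (Fin 4 → ℤ)) (f : Fin n → 𝓢(𝔼, ℝ))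
      (F : 𝓢((Fin n → 𝔼), ℂ)),
      LevelAdmissible (sch.L k) m → (∀ i, CellInHalfBox (sch.L k) m v (z i)) → Function.Injective z →
      (∀ i, tsupport (f i) ⊆ physCore (sch.a k) m v (z i)) → IsTensorOf F (fun i => ofRealTest (f i)) →
      ‖canonDistribution r sch k n (fun i => plaq r (q i)) F‖ ≤
        ∏ i, C * max (sch.a k * cellSide m) (sch.a k * cellSide m)⁻¹ ^ p * cellNorm s (sch.a k * cellSide m) (f i)

end Array

/-! ## §3 Anchor lemma -/

/-- An admissible level has `numCells = 2 w` cells per axis with `0 < w` (indeed `w = 3 u` where `2L+1 = 3^(m+1) u`):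
the EVEN cell count the chessboard estimate needs, on the odd torus. [folklore] -/
theorem numCells_eq_two_mul : ∀ {L m : ℕ}, LevelAdmissible L m → ∃ w : ℕ, numCells L m = 2 * w ∧ 0 < w := by
  intro L m hm
  obtain ⟨u, hu⟩ := hm
  have hu0 : 0 < u := Nat.pos_of_ne_zero fun h => by subst h; simp at hu
  refine ⟨3 * u, ?_, by omega⟩
  unfold numCells
  rw [hu, pow_succ, show 2 * (3 ^ m * 3 * u) = 3 ^ m * (2 * (3 * u)) by ring,
    Nat.mul_div_cancel_left _ (pow_pos (by norm_num) m)]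

end Summit.QuantumFields.YangMills.Theorems.ContinuumLegGivenGap.AlternatingArrays

end
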